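import Mathlib
import Summits.AtomisticToContinuum.HydrodynamicLimit.Theorems.ImplosionDichotomyDenseExcursionCavityUniformJunction
import Summits.AtomisticToContinuum.HydrodynamicLimit.Theorems.ImplosionDichotomyDenseExcursionCavityUniformDeep
import Summits.AtomisticToContinuum.HydrodynamicLimit.Theorems.ImplosionDichotomyDenseExcursionCavityNegExpBranch
import Summits.AtomisticToContinuum.HydrodynamicLimit.Theorems.ImplosionDichotomyDenseExcursionSonicCavityResolventUnique
import Summits.AtomisticToContinuum.HydrodynamicLimit.Theorems.ImplosionDichotomyDenseExcursionPackingRegularPairCk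

/-!
# The energy regime of the uniform weighted cavity resolvent: `Re Λ → +∞` in a sector (theorem T7(iii))
# (crux `DenseExcursion`, line `sonic-cavity-renewal`, bricks for stub `stub_cavityResolventCk`)

Helper file (`--supports stmt-AtomisticToContinuum-12586`, line lead a2, stub-worker E3 for `stub_cavityResolventCk`).
Registered helpers:

* `cavity_largeRe_apriori` — THE A-PRIORI ESTIMATE (no spectral hypotheses): for a monatomic tube profile and every sector
  slope `θ` there are `X₀` (`= 48`) and `C` such that for all `Λ` with `Re Λ ≥ X₀`, `|Im Λ| ≤ θ Re Λ`, every differentiable pair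
  `(ŵ, ŝ)` with FINITE weighted sup on `x ≤ 1` solving `Λŵ − linW = f`, `Λŝ − linS = g` on `x ≤ 1` obeys
  `sup_{x ≤ 1}(|ŵ| + eˣ|ŝ|) ≤ C·sup_{x ≤ 1}(|f| + eˣ|g|)` — uniformly in `Λ` in the sector, the source measured in the weighted
  `C⁰` norm (the `k = 0` part of `WCkBound`). Assembly of the three zones: outer `8e^{−x} ≤ Re Λ` (`cavity_outer_bound`:
  energy flux + repulsive-dissipative transport of `p`), junction `Re Λ/8 ≤ e^{−x} ≤ 8‖Λ‖` (`cavity_junction_bound`: Grönwall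
  over a length `≤ log(64(1 + |θ|))`), deep `8‖Λ‖eˣ ≤ 1` (`cavity_deep_bound`: frozen `V`, slaved `u`); `C = 2C_J + 4`,
  `C_J = 4·(64ρ₀)^{30ρ₀}`, `ρ₀ = 1 + |θ|`.
* `cavity_resolvent_largeRe` — THE ENERGY REGIME OF `CavityResolventCk` (theorem T7(iii) of the stub's decomposition, in the
  honest SECTOR form): under the stub's hypotheses, for every `θ` there are `X₀, C` such that for `Re Λ ≥ X₀`, `|Im Λ| ≤ θ Re Λ`
  and every centre-regular source with weighted sup `≤ N` on `x ≤ 1` the resolvent equation has a centre-regular solution on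
  `ℝ` (existence: `cavity_resolvent_pointwise_negexp`, `Re ν(Λ) ≤ −1` for `Re Λ ≥ b₊₊(0) + κ`), unique on `x ≤ 1`
  (`cavityResolvent_unique`), with weighted sup `≤ C·N` on `x ≤ 1` (`cavity_largeRe_apriori`).

WHY A SECTOR (worker E3 report, `work/stubs/E3_uniformity.REPORT.md` §3): with the source measured in weighted `C⁰` only, the
bound does NOT hold uniformly on the half-plane `Re Λ ≥ X₀` as `Im Λ → ∞`: a source phase-matched to the incoming acoustic family
in the oscillatory layer `Re Λ/8 ≲ S ≲ ‖Λ‖` (length `log(‖Λ‖/Re Λ)`, bounded in a sector) is focused geometrically and produces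
`ŵ ≈ const·N(‖Λ‖/Re Λ)²` deep in the core (scaling argument; CONFIRMED NUMERICALLY on `SS(r₂)`: along `Re Λ = 10` the weighted
`C⁰ → C⁰` ratio of the smooth centre-regular resolvent for such a source is `6.0, 23.0, 51.0` at `Im Λ = 40, 80, 120`, i.e.
`0.35·(‖Λ‖/Re Λ)²`, while unmodulated or anti-matched sources of the same weighted size stay below `1.3`). Uniformity along
`Im Λ → ∞` needs the `C^k` seminorm of the source, i.e. the high-frequency theory T7(ii). The two unbounded regimes are therefore
split by ARGUMENT, not by real part: damping-dominated (this file; all constants depend on `θ` only through `ρ₀ = 1 + |θ|`) vs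
oscillation-dominated (`|Im Λ| ≥ θ Re Λ`, T7(ii)).
Sources: folklore. Everything proved; no new definitions.
-/

noncomputable section

open Filter Set
open scoped Topology ContDiff

namespace Summit.AtomisticToContinuum.HydrodynamicLimit.Theorems.SonicCavityRenewal

open Summit.AtomisticToContinuum.HydrodynamicLimit.Theorems.R2OneModeTwoConditions
open Summit.AtomisticToContinuum.HydrodynamicLimit.Theorems.PackingAnalyticImplosion (iteratedDeriv_bound_of_isRegularPair)

/-! ## The a-priori estimate -/

/-- **Registered helper `cavity_largeRe_apriori` (worker E3, theorem T7(iii) of `stub_cavityResolventCk`): THE A-PRIORI WEIGHTED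
SUP ESTIMATE IN THE ENERGY REGIME, SECTOR FORM.** See the module docstring. [folklore] -/
theorem cavity_largeRe_apriori : ∀ (r : ℝ) (W S : ℝ → ℝ), IsMonatomicProfile r W S → CavityTube r W S → ∀ θ : ℝ, ∃ X₀ C : ℝ, 0 < C ∧ ∀ Λ : ℂ, X₀ ≤ Λ.re → |Λ.im| ≤ θ * Λ.re → ∀ (f g ŵ ŝ : ℝ → ℂ), Differentiable ℝ ŵ → Differentiable ℝ ŝ → (∃ B : ℝ, ∀ x, x ≤ 1 → ‖ŵ x‖ + Real.exp x * ‖ŝ x‖ ≤ B) → (∀ x, x ≤ 1 → Λ * ŵ x - linW r W S ŵ ŝ x = f x ∧ Λ * ŝ x - linS r W S ŵ ŝ x = g x) → ∀ N : ℝ, (∀ x, x ≤ 1 → ‖f x‖ + Real.exp x * ‖g x‖ ≤ N) → ∀ x, x ≤ 1 → ‖ŵ x‖ + Real.exp x * ‖ŝ x‖ ≤ C * N := by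
  intro r W S hP hT θ
  set ρ₀ : ℝ := 1 + |θ| with hρ₀
  set CJ : ℝ := 4 * Real.exp (30 * ρ₀ * Real.log (64 * ρ₀)) with hCJ
  have hCJ4 : 4 ≤ CJ := by
    have : 1 ≤ Real.exp (30 * ρ₀ * Real.log (64 * ρ₀)) := Real.one_le_exp (by
      have : 0 ≤ Real.log (64 * ρ₀) := Real.log_nonneg (by simp only [hρ₀]; linarith [abs_nonneg θ])
      positivity)
    simp only [hCJ]; linarith
  refine ⟨48, 2 * CJ + 4, by linarith, ?_⟩
  intro Λ hX hIm f g ŵ ŝ hŵ hŝ hBex hsol N hsrc x hx1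
  obtain ⟨B, hB⟩ := hBex
  set X : ℝ := Λ.re with hXdef
  have hXpos : 0 < X := by linarith
  have hN : 0 ≤ N := by
    have h := hsrc 0 (by norm_num)
    have : 0 ≤ ‖f 0‖ + Real.exp 0 * ‖g 0‖ := by positivity
    linarith
  -- the sector: `‖Λ‖ ≤ ρ₀ Re Λ`
  have hΛX : X ≤ ‖Λ‖ := le_trans (le_abs_self _) (Complex.abs_re_le_norm Λ)
  have hΛpos : 0 < ‖Λ‖ := by linarith
  have hsec : ‖Λ‖ ≤ ρ₀ * X := by
    have h1 : ‖Λ‖ ≤ |Λ.re| + |Λ.im| := Complex.norm_le_abs_re_add_abs_im Λ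
    have h2 : |Λ.re| = X := abs_of_pos hXpos
    have h3 : |Λ.im| ≤ |θ| * X := hIm.trans (mul_le_mul_of_nonneg_right (le_abs_self θ) hXpos.le)
    simp only [hρ₀]
    nlinarith
  -- the deep-zone edge
  set xd : ℝ := Real.log (1 / (8 * ‖Λ‖)) with hxddef
  have hxd : 8 * ‖Λ‖ * Real.exp xd = 1 := by
    rw [hxddef, Real.exp_log (by positivity)]; field_simp
  -- algebra: `(ŵ, ŝ)` from `(p, m)`
  have hws : ∀ y : ℝ, ∀ M : ℝ, ‖ŵ y + 3 * ŝ y‖ ≤ M → ‖ŵ y - 3 * ŝ y‖ ≤ M → ‖ŵ y‖ ≤ M ∧ ‖ŝ y‖ ≤ M / 3 := by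
    intro y M hp hm
    have e1 : (2 : ℂ) * ŵ y = (ŵ y + 3 * ŝ y) + (ŵ y - 3 * ŝ y) := by ring
    have e2 : (6 : ℂ) * ŝ y = (ŵ y + 3 * ŝ y) - (ŵ y - 3 * ŝ y) := by ring
    have n1 := norm_add_le (ŵ y + 3 * ŝ y) (ŵ y - 3 * ŝ y)
    have n2 := norm_sub_le (ŵ y + 3 * ŝ y) (ŵ y - 3 * ŝ y)
    rw [← e1, norm_mul] at n1
    rw [← e2, norm_mul] at n2
    norm_num at n1 n2
    exact ⟨by linarith, by linarith⟩
  by_cases hzone : 8 * Real.exp (-x) ≤ X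
  · -- outer zone
    obtain ⟨hp, hm⟩ := cavity_outer_bound r W S hP hT Λ f g ŵ ŝ N B hX hŵ hŝ hsol hsrc hB x hx1 hzone
    obtain ⟨hw, hs⟩ := hws x (3 * N) (hp.trans (by linarith)) hm
    have he : Real.exp x ≤ 3 := (Real.exp_le_exp.mpr hx1).trans (by
      have := Real.exp_one_lt_d9; norm_num at this ⊢; linarith)
    have : Real.exp x * ‖ŝ x‖ ≤ 3 * N := by
      calc Real.exp x * ‖ŝ x‖ ≤ 3 * (3 * N / 3) := mul_le_mul he hs (norm_nonneg _) (by norm_num)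
        _ = 3 * N := by ring
    nlinarith
  · push Not at hzone
    by_cases hzone2 : 1 ≤ 8 * ‖Λ‖ * Real.exp x
    · -- junction zone
      obtain ⟨hp, hm⟩ := cavity_junction_bound r W S hP hT Λ f g ŵ ŝ N B ρ₀ hX hsec hŵ hŝ hsol hsrc hB x hzone.le hzone2
      obtain ⟨hw, hs⟩ := hws x (CJ * N) (by simp only [hCJ]; linarith) (by simp only [hCJ]; linarith)
      have he : Real.exp x ≤ 1 := by
        have h1 : X < 8 * Real.exp (-x) := hzone
        have h2 : Real.exp (-x) ≥ 1 := by
          by_contra h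
          push Not at h
          linarith
        have h3 : Real.exp x * Real.exp (-x) = 1 := by rw [← Real.exp_add, add_neg_cancel, Real.exp_zero]
        nlinarith [Real.exp_pos x]
      have : Real.exp x * ‖ŝ x‖ ≤ CJ * N / 3 :=
        calc Real.exp x * ‖ŝ x‖ ≤ 1 * (CJ * N / 3) := mul_le_mul he hs (norm_nonneg _) zero_le_one
          _ = CJ * N / 3 := one_mul _
      nlinarith
    · -- deep zone
      push Not at hzone2
      have hxxd : x ≤ xd := by
        have h1 : Real.exp x ≤ 1 / (8 * ‖Λ‖) := by
          rw [le_div_iff₀ (by positivity)]; linarith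
        have h2 : Real.exp x ≤ Real.exp xd := by rwa [hxddef, Real.exp_log (by positivity)]
        exact Real.exp_le_exp.mp h2
      -- the datum at `xd` from the junction zone
      have hXd : X ≤ 8 * Real.exp (-xd) := by
        have h1 : Real.exp (-xd) = 8 * ‖Λ‖ := by
          rw [Real.exp_neg, hxddef, Real.exp_log (by positivity)]; field_simp
        rw [h1]; nlinarith
      obtain ⟨hpd, hmd⟩ := cavity_junction_bound r W S hP hT Λ f g ŵ ŝ N B ρ₀ hX hsec hŵ hŝ hsol hsrc hB xd hXd
        (by rw [hxd])
      obtain ⟨hw, hs⟩ := cavity_deep_bound r W S hP hT Λ f g ŵ ŝ N B (CJ * N) xd (le_trans hX hΛX) hŵ hŝ hsol hsrc hB hxd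
        (by simp only [hCJ]; linarith) (by simp only [hCJ]; linarith) x hxxd
      have h48 : (CJ * N + N) / ‖Λ‖ ≤ CJ * N + N := by
        rw [div_le_iff₀ hΛpos]
        have : 0 ≤ CJ * N + N := by positivity
        nlinarith
      nlinarith

/-! ## The energy regime of the cavity resolvent -/

/-- **Registered helper `cavity_resolvent_largeRe` (worker E3, theorem T7(iii) of `stub_cavityResolventCk`): THE ENERGY REGIME OF
THE UNIFORM WEIGHTED RESOLVENT BOUND, SECTOR FORM.** Under the hypotheses of `stub_cavityResolventCk`, for every sector slope `θ`
there are `X₀, C > 0` such that for `Re Λ ≥ X₀`, `|Im Λ| ≤ θ Re Λ` and every centre-regular source with weighted sup `≤ N` on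
`x ≤ 1` the resolvent equation has a centre-regular solution on `ℝ`, unique on `x ≤ 1` among centre-regular solutions, with
weighted sup `≤ C·N` on `x ≤ 1`. [folklore] -/
theorem cavity_resolvent_largeRe : ∀ (r : ℝ) (W S : ℝ → ℝ), (17307 / 15625 : ℝ) ≤ r → r ≤ 697 / 625 → IsMonatomicProfile r W S → OrigProfileEqs r W S → CavityTube r W S → BoxPackage r W S → RealBound r W S → SonicConfinement r W S → ∀ θ : ℝ, ∃ X₀ C : ℝ, 0 < C ∧ ∀ Λ : ℂ, X₀ ≤ Λ.re → |Λ.im| ≤ θ * Λ.re → ∀ (f g : ℝ → ℂ), IsRegularPair f g → ∀ N : ℝ, (∀ y, y ≤ 1 → ‖f y‖ + Real.exp y * ‖g y‖ ≤ N) → ∃ ŵ ŝ : ℝ → ℂ, IsRegularPair ŵ ŝ ∧ (∀ x, Λ * ŵ x - linW r W S ŵ ŝ x = f x ∧ Λ * ŝ x - linS r W S ŵ ŝ x = g x) ∧ (∀ x, x ≤ 1 → ‖ŵ x‖ + Real.exp x * ‖ŝ x‖ ≤ C * N) ∧ (∀ ŵ' ŝ' : ℝ → ℂ, IsRegularPair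 ŵ' ŝ' → (∀ x, Λ * ŵ' x - linW r W S ŵ' ŝ' x = f x ∧ Λ * ŝ' x - linS r W S ŵ' ŝ' x = g x) → ∀ x, x ≤ 1 → ŵ' x = ŵ x ∧ ŝ' x = ŝ x) := by
  intro r W S h1 h2 hP hE hT hbox hre him θ
  obtain ⟨X₁, C, hC, hapr⟩ := cavity_largeRe_apriori r W S hP hT θ
  have h2' : r ≤ 89409 / 80000 := h2.trans (by norm_num)
  obtain ⟨Λ₁, h6, h9, hmode, -⟩ := id hbox
  -- the sonic threshold `b₊₊(0) + κ`
  set b0 : ℝ := 2 / 3 * deriv W 0 + 2 * deriv S 0 + 2 * W 0 + 4 * S 0 - r with hb0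
  set κ : ℝ := -(deriv W 0 + deriv S 0) with hκ
  have hκpos : 0 < κ := by
    obtain ⟨-, -, -, -, hk, -⟩ := hT
    simp only [hκ]; linarith
  refine ⟨max X₁ (48 + |b0| + κ), C, hC, ?_⟩
  intro Λ hX hIm f g hfg N hN
  have hX₁ : X₁ ≤ Λ.re := le_trans (le_max_left _ _) hX
  have hX48 : 48 + |b0| + κ ≤ Λ.re := le_trans (le_max_right _ _) hX
  have hre48 : 48 ≤ Λ.re := by linarith [abs_nonneg b0]
  have hΛX : Λ.re ≤ ‖Λ‖ := le_trans (le_abs_self _) (Complex.abs_re_le_norm Λ)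
  have hr1 : 1 < r := hP.1
  -- the region conditions
  have hreg1 : -(1 / 5 : ℝ) ≤ Λ.re := by linarith
  have hdisc0 : (1 / 20 : ℝ) ≤ ‖Λ‖ := by linarith
  have hdisc1 : (1 / 20 : ℝ) ≤ ‖Λ - (Λ₁ : ℂ)‖ := by
    have h := Complex.abs_re_le_norm (Λ - (Λ₁ : ℂ))
    simp only [Complex.sub_re, Complex.ofReal_re] at h
    have : Λ₁ < 2 := by linarith
    linarith [le_abs_self (Λ.re - Λ₁)]
  have hdiscr : (1 / 20 : ℝ) ≤ ‖Λ - (r : ℂ)‖ := by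
    have h := Complex.abs_re_le_norm (Λ - (r : ℂ))
    simp only [Complex.sub_re, Complex.ofReal_re] at h
    linarith [le_abs_self (Λ.re - r)]
  have hν : ((((2 / 3 * deriv W 0 + 2 * deriv S 0 + 2 * W 0 + 4 * S 0 - r : ℝ) : ℂ) - Λ) /
      ((-(deriv W 0 + deriv S 0) : ℝ) : ℂ)).re ≤ -1 := by
    rw [Complex.div_ofReal_re, Complex.sub_re, Complex.ofReal_re, div_le_iff₀ hκpos]
    have : b0 ≤ |b0| := le_abs_self b0
    simp only [hb0, hκ] at *
    linarith
  -- existence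
  obtain ⟨ŵ, ŝ, hreg, hsol⟩ := cavity_resolvent_pointwise_negexp r W S h1 h2 hP hE hT hbox hre him Λ₁ h6 h9 hmode Λ
    hreg1 hdisc0 hdisc1 hdiscr hν f g hfg
  refine ⟨ŵ, ŝ, hreg, hsol, ?_, ?_⟩
  · -- the bound
    obtain ⟨B, hB⟩ := iteratedDeriv_bound_of_isRegularPair 0 ŵ ŝ hreg
    have hBw : ∀ x, x ≤ 1 → ‖ŵ x‖ + Real.exp x * ‖ŝ x‖ ≤ B := fun x hx => by
      simpa using hB x hx 0 le_rfl
    have hŵ : Differentiable ℝ ŵ := hreg.1.differentiable (by simp)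
    have hŝ : Differentiable ℝ ŝ := hreg.2.1.differentiable (by simp)
    exact hapr Λ hX₁ hIm f g ŵ ŝ hŵ hŝ ⟨B, hBw⟩ (fun x _ => hsol x) N hN
  · -- uniqueness
    intro ŵ' ŝ' hreg' hsol' x _
    exact cavityResolvent_unique r W S h1 h2' hP hT hbox hre him Λ₁ h6 h9 hmode Λ hreg1 hdisc0 hdisc1 hdiscr f g ŵ ŝ ŵ' ŝ'
      hreg hreg' hsol hsol' x

end Summit.AtomisticToContinuum.HydrodynamicLimit.Theorems.SonicCavityRenewal

end
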